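import Mathlib
import Summits.MatrixMultiplication.MatrixMultiplication.Theorems.FidelityWitnessesFidelityGapThreeSeventeenStubBorelNormalFormLimits

/-!
# Borel normal form, part 3: the unipotent translate `exp(D/ε)` — inherited and gained stability

Support file for `stub_borelNormalForm` (line `symbolic-square-border-apolarity` of
`FidelityWitnesses.FidelityGapThreeSeventeen`).  For a `K`-linear map `D` of `P = K[x_σ]`, nilpotent on
a finite-dimensional piece `S`, the scaled truncated exponential `Hx D N = ∑_{k ≤ N} ε^{N-k} D^k / k!`
acts on families `P[ε]` coefficientwise; it encodes the one-parameter unipotent subgroup `s ↦ exp(s D)`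
at `s = 1/ε`, and `Hx (-D) N` is its quasi-inverse (part 4).  Here: the generalised Leibniz rule, the
commutation rule `D^k E = E D^k + k D^{k-1} [D,E]` for `[D,[D,E]] = 0`, whence INHERITED stability of the
limit (`limW_Hx_stable_of_bracket`, `…_of_comm`), and the derivative identity
`Hx (ε² F' - D F) = ε² (Hx F)' - N ε Hx F`, whence the GAINED stability: the limit of `exp(D/ε) · W` is
`D`-stable (`limW_Hx_stable_self`) — the elementary replacement of the fixed point theorem for a root
subgroup (CHL 2023 §2.4; BB 2021 Thm 4.3).  General, PROVED.
-/

noncomputable section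

namespace Summit.MatrixMultiplication.MatrixMultiplication.Theorems.SymbolicSquare

-- single-conjunct summit: the `Summit.<S>.<P>` prefix repeats `MatrixMultiplication` by design (D-0017)
set_option linter.dupNamespace false

open scoped BigOperators Polynomial
open Polynomial

/-! ## The unipotent translate `exp(D/ε)`: basic identities, inherited and gained stability -/

namespace BorelLimit

universe u v

variable {K : Type u} [Field K] {σ : Type v}

section CwPow

variable (D : MvPolynomial σ K →ₗ[K] MvPolynomial σ K)

/-- `cw` is additive in the map: `cw (-ψ) = -cw ψ`. -/
theorem cw_neg (ψ : MvPolynomial σ K →ₗ[K] MvPolynomial σ K) : cw (-ψ) = -cw ψ := by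
  apply LinearMap.ext
  intro F
  ext t
  simp only [coeff_cw, LinearMap.neg_apply, coeff_neg]

/-- `cw` is additive in the map: `cw (ψ - φ) = cw ψ - cw φ`. -/
theorem cw_sub (ψ φ : MvPolynomial σ K →ₗ[K] MvPolynomial σ K) : cw (ψ - φ) = cw ψ - cw φ := by
  apply LinearMap.ext
  intro F
  ext t
  simp only [coeff_cw, LinearMap.sub_apply, coeff_sub]

/-- Powers of a coefficientwise map commute with `ε`. -/
theorem cwpow_X_mul (k : ℕ) (F : (MvPolynomial σ K)[X]) : (cw D ^ k) (X * F) = X * (cw D ^ k) F := by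
  rw [← cw_pow, cw_X_mul, cw_pow]

/-- Powers of a coefficientwise map commute with `ε^j`. -/
theorem cwpow_X_pow_mul (k j : ℕ) (F : (MvPolynomial σ K)[X]) :
    (cw D ^ k) (X ^ j * F) = X ^ j * (cw D ^ k) F := by
  rw [← cw_pow, cw_X_pow_mul, cw_pow]

/-- Powers of a coefficientwise map commute with `d/dε`. -/
theorem cwpow_derivative (k : ℕ) (F : (MvPolynomial σ K)[X]) :
    (cw D ^ k) (derivative F) = derivative ((cw D ^ k) F) := by
  rw [← cw_pow, cw_derivative, cw_pow]

/-- Powers of a coefficientwise map preserve `S[ε]` when `D S ⊆ S`. -/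
theorem cwpow_mem_famOf {S : Submodule K (MvPolynomial σ K)} (hDS : ∀ f ∈ S, D f ∈ S) (k : ℕ)
    {F : (MvPolynomial σ K)[X]} (hF : F ∈ famOf S) : (cw D ^ k) F ∈ famOf S := by
  induction k with
  | zero => simpa using hF
  | succ k ih => rw [pow_succ', Module.End.mul_apply]; exact cw_mem_famOf D hDS ih

/-- Nilpotency on `S` passes to `S[ε]`: `D^n S = 0`, `n ≤ k` give `(cw D)^k F = 0` for `F ∈ S[ε]`. -/
theorem cwpow_eq_zero {S : Submodule K (MvPolynomial σ K)} {n : ℕ} (hnil : ∀ f ∈ S, (D ^ n) f = 0) {k : ℕ}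
    (hk : n ≤ k) {F : (MvPolynomial σ K)[X]} (hF : F ∈ famOf S) : (cw D ^ k) F = 0 := by
  ext t
  rw [coeff_cw_pow, coeff_zero]
  obtain ⟨j, rfl⟩ := Nat.exists_eq_add_of_le hk
  rw [add_comm, pow_add, Module.End.mul_apply, hnil _ (hF t), map_zero]

/-- A coefficientwise map commuting with `D` commutes with the powers of `cw D`. -/
theorem cwpow_comm {C' : MvPolynomial σ K →ₗ[K] MvPolynomial σ K} (hC : D ∘ₗ C' = C' ∘ₗ D) (k : ℕ)
    (F : (MvPolynomial σ K)[X]) : (cw D ^ k) (cw C' F) = cw C' ((cw D ^ k) F) := by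
  induction k generalizing F with
  | zero => simp
  | succ k ih =>
      rw [pow_succ, Module.End.mul_apply, Module.End.mul_apply, ← ih]
      congr 1
      rw [← cw_comp, ← cw_comp, hC]

/-- **Generalised Leibniz rule** for the powers of a coefficientwise derivation:
`(cw D)^n (F G) = ∑ⱼ C(n,j) (cw D)^j F · (cw D)^{n-j} G`. -/
theorem cwpow_mul (hD : ∀ f g : MvPolynomial σ K, D (f * g) = D f * g + f * D g) (n : ℕ)
    (F G : (MvPolynomial σ K)[X]) :
    (cw D ^ n) (F * G) = ∑ j ∈ Finset.range (n + 1), (n.choose j : K) • ((cw D ^ j) F * (cw D ^ (n - j)) G) := by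
  induction n with
  | zero => simp
  | succ n ih =>
      set f : ℕ → (MvPolynomial σ K)[X] := fun j => (cw D ^ j) F * (cw D ^ (n + 1 - j)) G with hf
      rw [pow_succ', Module.End.mul_apply, ih, map_sum]
      have hterm : ∀ j ∈ Finset.range (n + 1),
          cw D ((n.choose j : K) • ((cw D ^ j) F * (cw D ^ (n - j)) G)) =
            (n.choose j : K) • f (j + 1) + (n.choose j : K) • f j := by
        intro j hj
        have hjn : j ≤ n := Nat.lt_succ_iff.1 (Finset.mem_range.1 hj)
        rw [map_smul, cw_mul_of_leibniz D hD, smul_add, hf]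
        simp only
        rw [show n + 1 - (j + 1) = n - j by omega, show n + 1 - j = n - j + 1 by omega, pow_succ',
          Module.End.mul_apply, pow_succ' (cw D) (n - j), Module.End.mul_apply]
      rw [Finset.sum_congr rfl hterm, Finset.sum_add_distrib]
      -- Pascal
      have eL : ∑ j ∈ Finset.range (n + 1), (n.choose j : K) • f j =
          ∑ j ∈ Finset.range n, (n.choose (j + 1) : K) • f (j + 1) + f 0 := by
        rw [Finset.sum_range_succ' (fun j => (n.choose j : K) • f j)]
        simp
      have eL' : ∑ j ∈ Finset.range (n + 1), (n.choose (j + 1) : K) • f (j + 1) =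
          ∑ j ∈ Finset.range n, (n.choose (j + 1) : K) • f (j + 1) := by
        rw [Finset.sum_range_succ, Nat.choose_succ_self, Nat.cast_zero, zero_smul, add_zero]
      have eR : ∑ j ∈ Finset.range (n + 1 + 1), ((n + 1).choose j : K) • f j =
          ∑ j ∈ Finset.range (n + 1), (n.choose j : K) • f (j + 1) +
            ∑ j ∈ Finset.range (n + 1), (n.choose (j + 1) : K) • f (j + 1) + f 0 := by
        rw [Finset.sum_range_succ' (fun j => ((n + 1).choose j : K) • f j), ← Finset.sum_add_distrib]
        simp only [Nat.choose_succ_succ, Nat.cast_add, add_smul, Nat.choose_zero_right, Nat.cast_one, one_smul]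
      rw [eR, eL', eL]
      abel

end CwPow

section Exp

variable (D : MvPolynomial σ K →ₗ[K] MvPolynomial σ K) (N : ℕ)

/-- The (scaled, truncated) EXPONENTIAL TRANSLATE `ε^N · exp(D/ε) = ∑_{k ≤ N} (1/k!) ε^{N-k} D^k`, acting
coefficientwise on families: the one-parameter unipotent subgroup generated by the nilpotent
derivation `D`, at the parameter `s = 1/ε`. -/
def Hx : (MvPolynomial σ K)[X] →ₗ[K] (MvPolynomial σ K)[X] :=
  ∑ k ∈ Finset.range (N + 1), ((k.factorial : K)⁻¹) • (LinearMap.mulLeft K (X ^ (N - k)) ∘ₗ (cw D ^ k))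

/-- Unfolding lemma for `Hx`. -/
theorem Hx_apply (F : (MvPolynomial σ K)[X]) :
    Hx D N F = ∑ k ∈ Finset.range (N + 1), ((k.factorial : K)⁻¹) • (X ^ (N - k) * (cw D ^ k) F) := by
  simp [Hx, LinearMap.sum_apply]

/-- `Hx` commutes with `ε`. -/
theorem Hx_X_mul (F : (MvPolynomial σ K)[X]) : Hx D N (X * F) = X * Hx D N F := by
  rw [Hx_apply, Hx_apply, Finset.mul_sum]
  refine Finset.sum_congr rfl fun k _ => ?_
  rw [cwpow_X_mul, mul_smul_comm, mul_left_comm]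

/-- `Hx` commutes with `ε^j`. -/
theorem Hx_X_pow_mul (j : ℕ) (F : (MvPolynomial σ K)[X]) : Hx D N (X ^ j * F) = X ^ j * Hx D N F :=
  map_X_pow_mul (Hx D N) (Hx_X_mul D N) j F

/-- `Hx` preserves `S[ε]` when `D S ⊆ S`. -/
theorem Hx_mem_famOf {S : Submodule K (MvPolynomial σ K)} (hDS : ∀ f ∈ S, D f ∈ S)
    {F : (MvPolynomial σ K)[X]} (hF : F ∈ famOf S) : Hx D N F ∈ famOf S := by
  rw [Hx_apply]
  refine Submodule.sum_mem _ fun k _ => Submodule.smul_mem _ _ ?_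
  exact (X_pow_mul_mem_famOf (N - k)).2 (cwpow_mem_famOf D hDS k hF)

/-- `Hx` commutes with a coefficientwise map commuting with `D`. -/
theorem Hx_cw_comm {C' : MvPolynomial σ K →ₗ[K] MvPolynomial σ K} (hC : D ∘ₗ C' = C' ∘ₗ D)
    (F : (MvPolynomial σ K)[X]) : Hx D N (cw C' F) = cw C' (Hx D N F) := by
  rw [Hx_apply, Hx_apply, map_sum]
  refine Finset.sum_congr rfl fun k _ => ?_
  rw [map_smul, cw_X_pow_mul, cwpow_comm D hC]

/-- The commutation rule `D^{k+1} E = E D^{k+1} + (k+1) D^k C` for `[D, E] = C` with `[D, C] = 0`,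
coefficientwise. -/
theorem cwpow_succ_cw_of_bracket {E C' : MvPolynomial σ K →ₗ[K] MvPolynomial σ K}
    (hE : D ∘ₗ E - E ∘ₗ D = C') (hC : D ∘ₗ C' = C' ∘ₗ D) (k : ℕ) (F : (MvPolynomial σ K)[X]) :
    (cw D ^ (k + 1)) (cw E F) = cw E ((cw D ^ (k + 1)) F) + ((k + 1 : ℕ) : K) • (cw D ^ k) (cw C' F) := by
  have base : ∀ G : (MvPolynomial σ K)[X], cw D (cw E G) = cw E (cw D G) + cw C' G := by
    intro G
    have h : cw (D ∘ₗ E - E ∘ₗ D) G = cw C' G := by rw [hE]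
    rw [cw_sub, LinearMap.sub_apply, cw_comp, cw_comp] at h
    rw [← h]
    abel
  induction k generalizing F with
  | zero => simp [base]
  | succ k ih =>
      have e1 : (cw D ^ (k + 1 + 1)) (cw E F) = cw D ((cw D ^ (k + 1)) (cw E F)) := by
        rw [pow_succ' (cw D) (k + 1), Module.End.mul_apply]
      have e2 : cw D (cw E ((cw D ^ (k + 1)) F)) = cw E ((cw D ^ (k + 1 + 1)) F) + cw C' ((cw D ^ (k + 1)) F) := by
        rw [base, pow_succ' (cw D) (k + 1), Module.End.mul_apply]
      have e3 : cw C' ((cw D ^ (k + 1)) F) = (cw D ^ (k + 1)) (cw C' F) := (cwpow_comm D hC (k + 1) F).symm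
      have e4 : cw D ((cw D ^ k) (cw C' F)) = (cw D ^ (k + 1)) (cw C' F) := by
        rw [pow_succ' (cw D) k, Module.End.mul_apply]
      rw [e1, ih F, map_add, map_smul, e2, e3, e4]
      simp only [Nat.cast_add, Nat.cast_one, add_smul, one_smul]
      abel

/-- `Hx (E F) = E (Hx F) + ∑_{k < N} (1/k!) ε^{N-k-1} D^k (C F)` for `[D, E] = C`, `[D, C] = 0`. -/
theorem Hx_cw_eq [CharZero K] {E C' : MvPolynomial σ K →ₗ[K] MvPolynomial σ K}
    (hE : D ∘ₗ E - E ∘ₗ D = C') (hC : D ∘ₗ C' = C' ∘ₗ D) (F : (MvPolynomial σ K)[X]) :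
    Hx D N (cw E F) = cw E (Hx D N F) +
      ∑ k ∈ Finset.range N, ((k.factorial : K)⁻¹) • (X ^ (N - k - 1) * (cw D ^ k) (cw C' F)) := by
  rw [Hx_apply, Hx_apply, map_sum]
  rw [Finset.sum_range_succ' (fun k => (k.factorial : K)⁻¹ • (X ^ (N - k) * (cw D ^ k) (cw E F)))]
  rw [Finset.sum_range_succ' (fun k => cw E ((k.factorial : K)⁻¹ • (X ^ (N - k) * (cw D ^ k) F)))]
  have h0 : (((0 : ℕ).factorial : K)⁻¹) • (X ^ (N - 0) * (cw D ^ 0) (cw E F)) =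
      cw E ((((0 : ℕ).factorial : K)⁻¹) • (X ^ (N - 0) * (cw D ^ 0) F)) := by
    simp [cw_X_pow_mul]
  have hA : ∑ k ∈ Finset.range N, (((k + 1).factorial : K)⁻¹) • (X ^ (N - (k + 1)) * (cw D ^ (k + 1)) (cw E F)) =
      ∑ k ∈ Finset.range N, cw E ((((k + 1).factorial : K)⁻¹) • (X ^ (N - (k + 1)) * (cw D ^ (k + 1)) F)) +
        ∑ k ∈ Finset.range N, ((k.factorial : K)⁻¹) • (X ^ (N - k - 1) * (cw D ^ k) (cw C' F)) := by
    rw [← Finset.sum_add_distrib]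
    refine Finset.sum_congr rfl fun k _ => ?_
    rw [cwpow_succ_cw_of_bracket D hE hC k F, mul_add, smul_add, map_smul, cw_X_pow_mul, add_right_inj,
      mul_smul_comm, smul_smul, show N - (k + 1) = N - k - 1 by omega]
    congr 1
    rw [Nat.factorial_succ]
    push_cast
    field_simp
  rw [h0, hA]
  abel

/-- **The inherited-stability identity** for the exponential translate: if `[D, E] = C`, `[D, C] = 0`,
`C S ⊆ S` and `D^N S = 0`, then on `S[ε]`: `ε · Hx (E F) = ε · E (Hx F) + C (Hx F)`. -/
theorem X_mul_Hx_cw [CharZero K] {S : Submodule K (MvPolynomial σ K)} {E C' : MvPolynomial σ K →ₗ[K] MvPolynomial σ K}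
    (hE : D ∘ₗ E - E ∘ₗ D = C') (hC : D ∘ₗ C' = C' ∘ₗ D) (hCS : ∀ f ∈ S, C' f ∈ S)
    (hnil : ∀ f ∈ S, (D ^ N) f = 0) {F : (MvPolynomial σ K)[X]} (hF : F ∈ famOf S) :
    X * Hx D N (cw E F) = X * cw E (Hx D N F) + cw C' (Hx D N F) := by
  have hCF : cw C' F ∈ famOf S := cw_mem_famOf C' hCS hF
  rw [Hx_cw_eq D N hE hC, mul_add, add_right_inj, ← Hx_cw_comm D N hC, Hx_apply, Finset.mul_sum,
    Finset.sum_range_succ, cwpow_eq_zero D hnil le_rfl hCF, mul_zero, smul_zero, add_zero]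
  refine Finset.sum_congr rfl fun k hk => ?_
  have hkN : k < N := Finset.mem_range.1 hk
  rw [mul_smul_comm, ← mul_assoc, ← pow_succ', show N - k - 1 + 1 = N - k by omega]

variable {D N}

/-- **Inherited stability, exponential case**: if `W` is `E`- and `C`-stable, `[D, E] = C`, `[D, C] = 0`,
`E, C` preserve `S` and `D^N S = 0`, then `lim W` (translate by `Hx D N`) is `E`-stable. -/
theorem limW_Hx_stable_of_bracket [CharZero K] {S W : Submodule K (MvPolynomial σ K)}
    {E C' : MvPolynomial σ K →ₗ[K] MvPolynomial σ K}
    (hE : D ∘ₗ E - E ∘ₗ D = C') (hC : D ∘ₗ C' = C' ∘ₗ D) (hES : ∀ f ∈ S, E f ∈ S)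
    (hCS : ∀ f ∈ S, C' f ∈ S) (hnil : ∀ f ∈ S, (D ^ N) f = 0)
    (hEW : ∀ f ∈ W, E f ∈ W) (hCW : ∀ f ∈ W, C' f ∈ W) :
    ∀ f ∈ limW (Hx D N) S W, E f ∈ limW (Hx D N) S W := by
  refine limW_stable (Hx D N) E hES 1 (LinearMap.mulLeft K X ∘ₗ cw E + cw C') ?_ ?_
  · intro G hG
    simp only [LinearMap.add_apply, LinearMap.comp_apply, LinearMap.mulLeft_apply]
    exact Submodule.add_mem _ (X_mul_mem_famOf.2 (cw_mem_famOf E hEW hG)) (cw_mem_famOf C' hCW hG)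
  · intro F hF
    simp only [LinearMap.add_apply, LinearMap.comp_apply, LinearMap.mulLeft_apply, pow_one]
    exact X_mul_Hx_cw D N hE hC hCS hnil hF

/-- Inherited stability, commuting case: `D E = E D`, `E` preserves `S` and `W` ⟹ `lim W` is `E`-stable. -/
theorem limW_Hx_stable_of_comm {S W : Submodule K (MvPolynomial σ K)} {E : MvPolynomial σ K →ₗ[K] MvPolynomial σ K}
    (hE : D ∘ₗ E = E ∘ₗ D) (hES : ∀ f ∈ S, E f ∈ S) (hEW : ∀ f ∈ W, E f ∈ W) :
    ∀ f ∈ limW (Hx D N) S W, E f ∈ limW (Hx D N) S W := by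
  refine limW_stable (Hx D N) E hES 0 (cw E) (fun G hG => cw_mem_famOf E hEW hG) ?_
  intro F _
  rw [pow_zero, one_mul, Hx_cw_comm D N hE]

variable (D N)

/-- `C n · P = n • P` for the constant `n ∈ ℕ ⊆ K ⊆ P`. -/
theorem C_natCast_mul (n : ℕ) (P : (MvPolynomial σ K)[X]) :
    C (n : MvPolynomial σ K) * P = (n : K) • P := by
  rw [← map_natCast (algebraMap K (MvPolynomial σ K)) n, ← smul_eq_C_mul, algebraMap_smul]

/-- `Hx (D F)`, shifted: `= ∑_{k ≤ N} k · (1/k!) ε^{N-k+1} D^k F` on `S[ε]` when `D^{N+1} S = 0`. -/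
theorem Hx_cw_self_eq [CharZero K] {S : Submodule K (MvPolynomial σ K)} (hnil : ∀ f ∈ S, (D ^ (N + 1)) f = 0)
    {F : (MvPolynomial σ K)[X]} (hF : F ∈ famOf S) :
    Hx D N (cw D F) = ∑ k ∈ Finset.range (N + 1),
      ((k : ℕ) : K) • (((k.factorial : K)⁻¹) • (X ^ (N - k + 1) * (cw D ^ k) F)) := by
  rw [Hx_apply]
  have h1 : ∀ k ∈ Finset.range (N + 1), (k.factorial : K)⁻¹ • (X ^ (N - k) * (cw D ^ k) (cw D F)) =
      (k.factorial : K)⁻¹ • (X ^ (N - k) * (cw D ^ (k + 1)) F) := by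
    intro k _
    rw [pow_succ, Module.End.mul_apply]
  rw [Finset.sum_congr rfl h1, Finset.sum_range_succ, cwpow_eq_zero D hnil le_rfl hF, mul_zero, smul_zero,
    add_zero, Finset.sum_range_succ']
  simp only [Nat.cast_zero, zero_smul, add_zero]
  refine Finset.sum_congr rfl fun k hk => ?_
  have hkN : k < N := Finset.mem_range.1 hk
  rw [smul_smul, show N - (k + 1) + 1 = N - k by omega]
  congr 1
  rw [Nat.factorial_succ]
  push_cast
  field_simp

/-- `ε² (Hx F)'`: differentiate `ε^{N-k}` and `F`. -/
theorem X_sq_mul_derivative_Hx (F : (MvPolynomial σ K)[X]) :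
    X ^ 2 * derivative (Hx D N F) = ∑ k ∈ Finset.range (N + 1),
      ((N - k : ℕ) : K) • (((k.factorial : K)⁻¹) • (X ^ (N - k + 1) * (cw D ^ k) F)) +
        X ^ 2 * Hx D N (derivative F) := by
  rw [Hx_apply, Hx_apply, derivative_sum, Finset.mul_sum, Finset.mul_sum, ← Finset.sum_add_distrib]
  refine Finset.sum_congr rfl fun k _ => ?_
  rw [derivative_smul, derivative_mul, derivative_X_pow, ← cwpow_derivative, smul_add, mul_add, add_left_inj,
    mul_smul_comm, smul_comm]
  congr 1
  rw [mul_assoc, ← mul_assoc (X ^ 2), mul_comm (X ^ 2) (C _), mul_assoc, ← mul_assoc (X ^ 2), ← pow_add,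
    C_natCast_mul]
  rcases Nat.eq_zero_or_pos (N - k) with h0 | hpos
  · rw [h0]; simp
  · rw [show 2 + (N - k - 1) = N - k + 1 by omega]

/-- **The derivative identity**: `Hx (ε² F' - D F) = ε² (Hx F)' - N ε Hx F` on `S[ε]` when
`D^{N+1} S = 0` (the chain rule for `ε ↦ exp(D/ε)`). -/
theorem Hx_sub_eq [CharZero K] {S : Submodule K (MvPolynomial σ K)} (hnil : ∀ f ∈ S, (D ^ (N + 1)) f = 0)
    {F : (MvPolynomial σ K)[X]} (hF : F ∈ famOf S) :
    Hx D N (X ^ 2 * derivative F - cw D F) =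
      X ^ 2 * derivative (Hx D N F) - (N : K) • (X * Hx D N F) := by
  rw [map_sub, Hx_X_pow_mul, Hx_cw_self_eq D N hnil hF, X_sq_mul_derivative_Hx]
  have h3 : (N : K) • (X * Hx D N F) = ∑ k ∈ Finset.range (N + 1),
      (N : K) • (((k.factorial : K)⁻¹) • (X ^ (N - k + 1) * (cw D ^ k) F)) := by
    rw [Hx_apply, Finset.mul_sum, Finset.smul_sum]
    refine Finset.sum_congr rfl fun k _ => ?_
    rw [mul_smul_comm, ← mul_assoc, ← pow_succ']
  rw [h3]
  have hkey : ∑ k ∈ Finset.range (N + 1), ((N - k : ℕ) : K) • (((k.factorial : K)⁻¹) • (X ^ (N - k + 1) * (cw D ^ k) F))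
      - ∑ k ∈ Finset.range (N + 1), (N : K) • (((k.factorial : K)⁻¹) • (X ^ (N - k + 1) * (cw D ^ k) F)) =
      -∑ k ∈ Finset.range (N + 1), ((k : ℕ) : K) • (((k.factorial : K)⁻¹) • (X ^ (N - k + 1) * (cw D ^ k) F)) := by
    rw [← Finset.sum_sub_distrib, ← Finset.sum_neg_distrib]
    refine Finset.sum_congr rfl fun k hk => ?_
    have hkN : k ≤ N := Nat.lt_succ_iff.1 (Finset.mem_range.1 hk)
    rw [← sub_smul, Nat.cast_sub hkN, ← neg_smul]
    congr 1
    ring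
  linear_combination -hkey

variable {D N}

/-- **Gained stability, exponential case**: the limit of the translates `exp(D/ε) · W` is `D`-stable
(`D S ⊆ S`, `D^{N+1} S = 0`; the lattice is tested through `Hx (-D) N = ε^N exp(-D/ε)`). For
`F ∈ lat`, the family `D F + ε² F'` is again in the lattice and has constant term `D F(0)`. -/
theorem limW_Hx_stable_self [CharZero K] {S W : Submodule K (MvPolynomial σ K)} (hDS : ∀ f ∈ S, D f ∈ S)
    (hnil : ∀ f ∈ S, (D ^ (N + 1)) f = 0) :
    ∀ f ∈ limW (Hx (-D) N) S W, D f ∈ limW (Hx (-D) N) S W := by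
  intro f hf
  obtain ⟨F, hF, rfl⟩ := (mem_limW (Hx (-D) N)).1 hf
  have hnil' : ∀ f ∈ S, ((-D) ^ (N + 1)) f = 0 := by
    intro g hg
    rw [show -D = (-1 : K) • D from (neg_one_smul K D).symm, _root_.smul_pow, LinearMap.smul_apply, hnil g hg,
      smul_zero]
  set F₂ : (MvPolynomial σ K)[X] := X ^ 2 * derivative F - cw (-D) F with hF₂
  have hF₂S : F₂ ∈ famOf S := by
    refine Submodule.sub_mem _ ((X_pow_mul_mem_famOf 2).2 (derivative_mem_famOf hF.1)) ?_
    rw [cw_neg, LinearMap.neg_apply]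
    exact Submodule.neg_mem _ (cw_mem_famOf D hDS hF.1)
  have hF₂lat : F₂ ∈ lat (Hx (-D) N) S W := by
    refine (mem_lat _).2 ⟨hF₂S, ?_⟩
    rw [hF₂, Hx_sub_eq (-D) N hnil' hF.1]
    exact Submodule.sub_mem _ ((X_pow_mul_mem_famOf 2).2 (derivative_mem_famOf hF.2))
      (Submodule.smul_mem _ _ (X_mul_mem_famOf.2 hF.2))
  have h0 : F₂.coeff 0 = D (F.coeff 0) := by
    rw [hF₂, coeff_sub, cw_neg, LinearMap.neg_apply, coeff_neg, coeff_cw, sub_neg_eq_add, pow_two, mul_assoc,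
      coeff_X_mul_zero, zero_add]
  rw [← h0]
  exact coeff_zero_mem_limW _ hF₂lat

end Exp

end BorelLimit


/-- **Part 3 of `stub_borelNormalForm` (registered helper stub): the limit of the unipotent translates
`exp(D/ε) · W` is `D`-stable** (`D S ⊆ S`, `D^{N+1} S = 0`; lattice tested through `Hx (-D) N`). -/
theorem stub_borelNormalForm_exp : ∀ {K : Type} [Field K] [CharZero K] {σ : Type}
    (D : MvPolynomial σ K →ₗ[K] MvPolynomial σ K) (N : ℕ) {S W : Submodule K (MvPolynomial σ K)},
    (∀ f ∈ S, D f ∈ S) → (∀ f ∈ S, (D ^ (N + 1)) f = 0) →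
    ∀ f ∈ BorelLimit.limW (BorelLimit.Hx (-D) N) S W, D f ∈ BorelLimit.limW (BorelLimit.Hx (-D) N) S W :=
  fun _ _ _ _ hDS hnil => BorelLimit.limW_Hx_stable_self hDS hnil

end Summit.MatrixMultiplication.MatrixMultiplication.Theorems.SymbolicSquare

end
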